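import Summits.CriticalPhenomena.PercolationContinuityZ3.Theorems.PercNearOneGluingNoHeavyLowerTailThreePointProductFormFibreCutVertex
import Summits.CriticalPhenomena.PercolationContinuityZ3.Theorems.PercNearOneGluingNoHeavyLowerTailThreePointProductFormFibreAdjacentClusters
import HarnessLib

/-!
# The refined product form `(P-adj)` across a cut vertex (Sahi programme, prover prim-sahi-p2 gen 56)

Support file (`--supports stmt-CriticalPhenomena-4575`, helper); continues `…ThreePointProductFormFibreCutVertex` (gen 54: CONJECTURE (P) when the apex
separates `s` from `c`) and `…ThreePointProductFormFibreAdjacentClusters` (gen 56: the entry lemma and the refined two-point fact `V ≤ Dn^adj`).  Standard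
axioms, no sorries, no named facts, no definitions.  Memo `run/shared/lean/prim/prim-sahi/FROM-prim-sahi-p2-gen56-REFINED-PRODUCT-FORM.md` §2.

SETTING as in `…FibreCutVertex`: a finite multigraph `(V, α, ends)`, an apex `a ∉ S` separating the vertex set `S ∋ s` from the rest `∌ c` (every label inside
`S ∪ {a}` or inside `Sᶜ ∪ {a}`); `R z x y` = open connection, `♭z = clusterFlip ends a z̄`; two clusters are ADJACENT when a closed label joins them.
* `reachable_of_agree_avoiding` [this work] — LOCALITY FOR A TERMINAL: if `t ∈ S` is separated from the apex in `z`, every `z`-connection `t ↔ y` is a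
  `z'`-connection for any `z'` agreeing with `z` on the non-loop labels inside `S ∪ {a}` (a walk from `t` avoiding `a` stays in `S`).
* `sepAdj_of_agree` [this work] — the refined event `{a ↮ t, apex cluster adjacent to the cluster of t}` (`t ∈ S`) is determined by the non-loop labels
  inside `S ∪ {a}` (the adjacency label has an endpoint in `C_t ⊆ S`, so it is an inside label).
* **`productFormAdj_of_separates`** [this work] — (P-adj) ACROSS A CUT VERTEX: if `a` separates `s` from `c` then
  `#bad² ≤ #P1ᵃ · #P2ᵃ`, `P1ᵃ = {a ↔ s, a ↮ c, C_a adjacent to C_c}`, `P2ᵃ = {a ↔ c, a ↮ s, C_a adjacent to C_s}` — the Schur/Hadamard square of the refined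
  two-point matrices `[[Cn, V],[V, Dn^adj]]` (`…FibreAdjacentClusters.card_virtual_le_card_disc_adj`), assembled with the independence count of `…FibreCutVertex`.
  Since `P1ᵃ ⊆ P1`, this sharpens `productForm_of_separates`.
CONJECTURE (P-adj) (gen 56; 0 exceptions in the census of the memo) asserts the same inequality on every finite multigraph.  [folklore] (walks through a cut
vertex; product counting); [cite: Gladkov2024, Conjecture 10.1 (p. 18), arXiv:2408.08457] for CONJECTURE (P) served.
-/

namespace Summit.CriticalPhenomena.PercolationContinuityZ3.Theorems.ProductFormFibre

open Finset Literature.Probability.Percolation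
open Summit.CriticalPhenomena.PercolationContinuityZ3.Theorems.ThreePointCPIClusterSwap (clusterFlip)

variable {V α : Type*}

section Locality

variable (ends : α → Sym2 V) (a : V) (S : Set V)

/-- A `z`-walk inside `S` (starting in `S`, avoiding `a`) is a `z'`-walk whenever `z'` is open on the `z`-open non-loop labels inside `S ∪ {a}`. [this work] -/
theorem reachable_of_walk_avoiding [DecidableEq V]
    (hsep : ∀ l : α, (∀ v ∈ ends l, v ∈ S ∨ v = a) ∨ (∀ v ∈ ends l, v ∉ S ∨ v = a)) (haS : a ∉ S)
    {z z' : α → Bool} (hagree : ∀ l, (∀ v ∈ ends l, v ∈ S ∨ v = a) → ¬ (ends l).IsDiag → z l = z' l) :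
    ∀ {u y : V} (p : (openGraph (labelledOpen ends z)).Walk u y), u ∈ S → a ∉ p.support →
      (openGraph (labelledOpen ends z')).Reachable u y
  | _, _, .nil, _, _ => SimpleGraph.Reachable.refl _
  | u, y, .cons (v := v) h q, hu, hap => by
      rw [SimpleGraph.Walk.support_cons, List.mem_cons, not_or] at hap
      have hv : v ∈ S := by
        rcases mem_or_eq_of_adj ends a S hsep haS z h hu with hv | hv
        · exact hv
        · exact absurd (hv ▸ q.start_mem_support) hap.2
      have h' : (openGraph (labelledOpen ends z')).Adj u v := by
        rw [openGraph_adj] at h ⊢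
        obtain ⟨⟨l, hl, hle⟩, hne⟩ := h
        refine ⟨⟨l, ?_, hle⟩, hne⟩
        have hins := inside_of_edge ends a S hsep hle (Or.inl hu) (Or.inl hv) hne
        have hnd : ¬ (ends l).IsDiag := by rw [hle, Sym2.mk_isDiag_iff]; exact hne
        rw [← hagree l hins hnd]; exact hl
      exact h'.reachable.trans (reachable_of_walk_avoiding hsep haS hagree q hv hap.2)

/-- **LOCALITY FOR A TERMINAL.**  If `t ∈ S` is separated from the apex in `z`, then every `z`-connection `t ↔ y` is a `z'`-connection for any
configuration `z'` agreeing with `z` on the non-loop labels inside `S ∪ {a}`. [this work] -/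
theorem reachable_of_agree_avoiding [DecidableEq V]
    (hsep : ∀ l : α, (∀ v ∈ ends l, v ∈ S ∨ v = a) ∨ (∀ v ∈ ends l, v ∉ S ∨ v = a)) (haS : a ∉ S)
    {z z' : α → Bool} (hagree : ∀ l, (∀ v ∈ ends l, v ∈ S ∨ v = a) → ¬ (ends l).IsDiag → z l = z' l)
    {t y : V} (ht : t ∈ S) (hat : ¬ (openGraph (labelledOpen ends z)).Reachable a t)
    (h : (openGraph (labelledOpen ends z)).Reachable t y) :
    (openGraph (labelledOpen ends z')).Reachable t y := by
  obtain ⟨p⟩ := h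
  have hap : a ∉ p.support := fun ha => hat ⟨(p.takeUntil a ha).reverse⟩
  exact reachable_of_walk_avoiding ends a S hsep haS hagree p ht hap

/-- **The refined event `{a ↮ t, C_a adjacent to C_t}` (`t ∈ S`) is determined inside `S ∪ {a}`.** [this work] -/
theorem sepAdj_of_agree [DecidableEq V]
    (hsep : ∀ l : α, (∀ v ∈ ends l, v ∈ S ∨ v = a) ∨ (∀ v ∈ ends l, v ∉ S ∨ v = a)) (haS : a ∉ S)
    {z z' : α → Bool} (hagree : ∀ l, (∀ v ∈ ends l, v ∈ S ∨ v = a) → ¬ (ends l).IsDiag → z l = z' l)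
    {t : V} (ht : t ∈ S)
    (h : ¬ (openGraph (labelledOpen ends z)).Reachable a t ∧
      ∃ l, z l = false ∧ ∃ x y : V, ends l = s(x, y) ∧
        (openGraph (labelledOpen ends z)).Reachable a x ∧ (openGraph (labelledOpen ends z)).Reachable t y) :
    ¬ (openGraph (labelledOpen ends z')).Reachable a t ∧
      ∃ l, z' l = false ∧ ∃ x y : V, ends l = s(x, y) ∧
        (openGraph (labelledOpen ends z')).Reachable a x ∧ (openGraph (labelledOpen ends z')).Reachable t y := by
  obtain ⟨hat, l, hzl, x, y, hle, hax, hty⟩ := h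
  have hat' : ¬ (openGraph (labelledOpen ends z')).Reachable a t :=
    fun h' => hat ((reachable_iff_of_agree_inside ends a S hsep haS hagree (Or.inl ht)).2 h')
  -- `y ∈ S`: the walk `t → y` avoids `a`
  have hy : y ∈ S := by
    obtain ⟨p⟩ := hty
    have hap : a ∉ p.support := fun ha => hat ⟨(p.takeUntil a ha).reverse⟩
    exact support_subset_of_walk ends a S hsep haS z p ht hap y p.end_mem_support
  have hya : y ≠ a := fun h => haS (h ▸ hy)
  -- the adjacency label is a non-loop inside label
  have hx : x ∈ S ∨ x = a := separates_elim ends a S hsep (hle.trans Sym2.eq_swap) hy hya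
  have hins : ∀ v ∈ ends l, v ∈ S ∨ v = a := by
    intro v hv
    rw [hle, Sym2.mem_iff] at hv
    rcases hv with rfl | rfl
    · exact hx
    · exact Or.inl hy
  have hxy : x ≠ y := fun h => hat ((h ▸ hax).trans hty.symm)
  have hnd : ¬ (ends l).IsDiag := by rw [hle, Sym2.mk_isDiag_iff]; exact hxy
  refine ⟨hat', l, ?_, x, y, hle, ?_, ?_⟩
  · rw [← hagree l hins hnd]; exact hzl
  · exact (reachable_iff_of_agree_inside ends a S hsep haS hagree hx).1 hax
  · exact reachable_of_agree_avoiding ends a S hsep haS hagree ht hat hty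

end Locality

section CutVertexAdj

variable [Fintype α] [DecidableEq α] [DecidableEq V]

open Classical in
/-- **(P-adj) ACROSS A CUT VERTEX.**  On a finite multigraph `(V, α, ends)` in which every label lies inside `S ∪ {a}` or outside `S` (`a ∉ S`), for
`s ∈ S` and `c ∉ S`, `c ≠ a`:  `#{z : a ↮ s, a ↮ c, s ↮ c in z, s ↔ c in ♭z}² ≤ #P1ᵃ · #P2ᵃ` with
`P1ᵃ = {a ↔ s, a ↮ c, some closed label joins C_a to C_c}` and `P2ᵃ = {a ↔ c, a ↮ s, some closed label joins C_a to C_s}`. [this work] -/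
theorem productFormAdj_of_separates (ends : α → Sym2 V) (a s c : V) (S : Set V)
    (hsep : ∀ l : α, (∀ v ∈ ends l, v ∈ S ∨ v = a) ∨ (∀ v ∈ ends l, v ∉ S ∨ v = a))
    (haS : a ∉ S) (hs : s ∈ S) (hcS : c ∉ S) (hca : c ≠ a) :
    (univ.filter fun z : α → Bool =>
        (¬ (openGraph (labelledOpen ends z)).Reachable a s ∧ ¬ (openGraph (labelledOpen ends z)).Reachable a c ∧
          ¬ (openGraph (labelledOpen ends z)).Reachable s c) ∧
        (openGraph (labelledOpen ends (clusterFlip ends a fun l => !z l))).Reachable s c).card ^ 2 ≤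
    (univ.filter fun z : α → Bool =>
        ((openGraph (labelledOpen ends z)).Reachable a s ∧ ¬ (openGraph (labelledOpen ends z)).Reachable a c) ∧
        ∃ l, z l = false ∧ ∃ x y' : V, ends l = s(x, y') ∧
          (openGraph (labelledOpen ends z)).Reachable a x ∧ (openGraph (labelledOpen ends z)).Reachable c y').card *
    (univ.filter fun z : α → Bool =>
        ((openGraph (labelledOpen ends z)).Reachable a c ∧ ¬ (openGraph (labelledOpen ends z)).Reachable a s) ∧
        ∃ l, z l = false ∧ ∃ x y' : V, ends l = s(x, y') ∧
          (openGraph (labelledOpen ends z)).Reachable a x ∧ (openGraph (labelledOpen ends z)).Reachable s y').card := by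
  -- the outside of the separator
  set T : Set V := {v : V | v ∉ S ∧ v ≠ a} with hT
  have hsepT := separates_compl ends a S hsep
  have haT : a ∉ T := fun h => h.2 rfl
  have hcT : c ∈ T := ⟨hcS, hca⟩
  let ins : α → Prop := fun l => (∀ v ∈ ends l, v ∈ S ∨ v = a) ∧ ¬ (ends l).IsDiag
  have hagS : ∀ z z' : α → Bool, (∀ l, ins l → z l = z' l) →
      ∀ l, (∀ v ∈ ends l, v ∈ S ∨ v = a) → ¬ (ends l).IsDiag → z l = z' l :=
    fun z z' h l hl hd => h l ⟨hl, hd⟩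
  have hagT : ∀ z z' : α → Bool, (∀ l, ¬ ins l → z l = z' l) →
      ∀ l, (∀ v ∈ ends l, v ∈ T ∨ v = a) → ¬ (ends l).IsDiag → z l = z' l := by
    intro z z' h l hl hd
    refine h l fun hins => hd (isDiag_of_forall_eq (a := a) fun v hv => ?_)
    rcases hins.1 v hv with h1 | h1
    · rcases hl v hv with h2 | h2
      · exact absurd h1 h2.1
      · exact h2
    · exact h1
  -- the bad set is the intersection of the two 'virtually joined' events
  have hbad_eq : (univ.filter fun z : α → Bool =>
        (¬ (openGraph (labelledOpen ends z)).Reachable a s ∧ ¬ (openGraph (labelledOpen ends z)).Reachable a c ∧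
          ¬ (openGraph (labelledOpen ends z)).Reachable s c) ∧
        (openGraph (labelledOpen ends (clusterFlip ends a fun l => !z l))).Reachable s c) =
      (univ.filter fun z : α → Bool =>
        (¬ (openGraph (labelledOpen ends z)).Reachable a s ∧
          (openGraph (labelledOpen ends (clusterFlip ends a fun l => !z l))).Reachable a s) ∧
        (¬ (openGraph (labelledOpen ends z)).Reachable a c ∧
          (openGraph (labelledOpen ends (clusterFlip ends a fun l => !z l))).Reachable a c)) := by
    refine Finset.filter_congr fun z _ => ?_
    constructor
    · rintro ⟨⟨h1, h2, h3⟩, h4⟩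
      have hsplit := reachable_apex_of_reachable ends a S hsep haS (clusterFlip ends a fun l => !z l) hs hcS h4
      exact ⟨⟨h1, hsplit.1.symm⟩, ⟨h2, hsplit.2⟩⟩
    · rintro ⟨⟨h1, h1'⟩, ⟨h2, h2'⟩⟩
      refine ⟨⟨h1, h2, fun h3 => h1 ?_⟩, h1'.symm.trans h2'⟩
      exact (reachable_apex_of_reachable ends a S hsep haS z hs hcS h3).1.symm
  -- `P1ᵃ`, `P2ᵃ` regrouped as (inside event) ∧ (outside event)
  have hP1_eq : (univ.filter fun z : α → Bool =>
        ((openGraph (labelledOpen ends z)).Reachable a s ∧ ¬ (openGraph (labelledOpen ends z)).Reachable a c) ∧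
        ∃ l, z l = false ∧ ∃ x y' : V, ends l = s(x, y') ∧
          (openGraph (labelledOpen ends z)).Reachable a x ∧ (openGraph (labelledOpen ends z)).Reachable c y') =
      (univ.filter fun z : α → Bool =>
        (openGraph (labelledOpen ends z)).Reachable a s ∧
        (¬ (openGraph (labelledOpen ends z)).Reachable a c ∧
          ∃ l, z l = false ∧ ∃ x y' : V, ends l = s(x, y') ∧
            (openGraph (labelledOpen ends z)).Reachable a x ∧ (openGraph (labelledOpen ends z)).Reachable c y')) :=
    Finset.filter_congr fun z _ => by
      constructor
      · rintro ⟨⟨h1, h2⟩, h3⟩; exact ⟨h1, h2, h3⟩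
      · rintro ⟨h1, h2, h3⟩; exact ⟨⟨h1, h2⟩, h3⟩
  have hP2_eq : (univ.filter fun z : α → Bool =>
        ((openGraph (labelledOpen ends z)).Reachable a c ∧ ¬ (openGraph (labelledOpen ends z)).Reachable a s) ∧
        ∃ l, z l = false ∧ ∃ x y' : V, ends l = s(x, y') ∧
          (openGraph (labelledOpen ends z)).Reachable a x ∧ (openGraph (labelledOpen ends z)).Reachable s y') =
      (univ.filter fun z : α → Bool =>
        (¬ (openGraph (labelledOpen ends z)).Reachable a s ∧
          ∃ l, z l = false ∧ ∃ x y' : V, ends l = s(x, y') ∧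
            (openGraph (labelledOpen ends z)).Reachable a x ∧ (openGraph (labelledOpen ends z)).Reachable s y') ∧
        (openGraph (labelledOpen ends z)).Reachable a c) :=
    Finset.filter_congr fun z _ => by
      constructor
      · rintro ⟨⟨h1, h2⟩, h3⟩; exact ⟨⟨h2, h3⟩, h1⟩
      · rintro ⟨⟨h2, h3⟩, h1⟩; exact ⟨⟨h1, h2⟩, h3⟩
  -- the three independence counts
  have hIbad := card_and_mul_card_univ ins
    (fun z => ¬ (openGraph (labelledOpen ends z)).Reachable a s ∧
      (openGraph (labelledOpen ends (clusterFlip ends a fun l => !z l))).Reachable a s)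
    (fun z => ¬ (openGraph (labelledOpen ends z)).Reachable a c ∧
      (openGraph (labelledOpen ends (clusterFlip ends a fun l => !z l))).Reachable a c)
    (fun z z' h hz => (virtual_iff_of_agree ends a S hsep haS (hagS z z' h) (Or.inl hs)).1 hz)
    (fun z z' h hz => (virtual_iff_of_agree ends a T hsepT haT (hagT z z' h) (Or.inl hcT)).1 hz)
  have hIP1 := card_and_mul_card_univ ins
    (fun z => (openGraph (labelledOpen ends z)).Reachable a s)
    (fun z => ¬ (openGraph (labelledOpen ends z)).Reachable a c ∧
      ∃ l, z l = false ∧ ∃ x y' : V, ends l = s(x, y') ∧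
        (openGraph (labelledOpen ends z)).Reachable a x ∧ (openGraph (labelledOpen ends z)).Reachable c y')
    (fun z z' h hz => (reachable_iff_of_agree_inside ends a S hsep haS (hagS z z' h) (Or.inl hs)).1 hz)
    (fun z z' h hz => sepAdj_of_agree ends a T hsepT haT (hagT z z' h) hcT hz)
  have hIP2 := card_and_mul_card_univ ins
    (fun z => ¬ (openGraph (labelledOpen ends z)).Reachable a s ∧
      ∃ l, z l = false ∧ ∃ x y' : V, ends l = s(x, y') ∧
        (openGraph (labelledOpen ends z)).Reachable a x ∧ (openGraph (labelledOpen ends z)).Reachable s y')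
    (fun z => (openGraph (labelledOpen ends z)).Reachable a c)
    (fun z z' h hz => sepAdj_of_agree ends a S hsep haS (hagS z z' h) hs hz)
    (fun z z' h hz => (reachable_iff_of_agree_inside ends a T hsepT haT (hagT z z' h) (Or.inl hcT)).1 hz)
  beta_reduce at hIbad hIP1 hIP2
  -- the refined two-point facts on each side
  have e1F := card_virtual_le_card_conn ends a s
  have e1G := card_virtual_le_card_disc_adj ends a s
  have e2F := card_virtual_le_card_conn ends a c
  have e2G := card_virtual_le_card_disc_adj ends a c
  rw [hbad_eq, hP1_eq, hP2_eq]
  set U := (univ : Finset (α → Bool)).card with hU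
  set B := (univ.filter fun z : α → Bool =>
        (¬ (openGraph (labelledOpen ends z)).Reachable a s ∧
          (openGraph (labelledOpen ends (clusterFlip ends a fun l => !z l))).Reachable a s) ∧
        (¬ (openGraph (labelledOpen ends z)).Reachable a c ∧
          (openGraph (labelledOpen ends (clusterFlip ends a fun l => !z l))).Reachable a c)).card with hB
  set E1 := (univ.filter fun z : α → Bool => ¬ (openGraph (labelledOpen ends z)).Reachable a s ∧
        (openGraph (labelledOpen ends (clusterFlip ends a fun l => !z l))).Reachable a s).card with hE1
  set E2 := (univ.filter fun z : α → Bool => ¬ (openGraph (labelledOpen ends z)).Reachable a c ∧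
        (openGraph (labelledOpen ends (clusterFlip ends a fun l => !z l))).Reachable a c).card with hE2
  set F1 := (univ.filter fun z : α → Bool => (openGraph (labelledOpen ends z)).Reachable a s).card with hF1
  set G1 := (univ.filter fun z : α → Bool => ¬ (openGraph (labelledOpen ends z)).Reachable a s ∧
      ∃ l, z l = false ∧ ∃ x y' : V, ends l = s(x, y') ∧
        (openGraph (labelledOpen ends z)).Reachable a x ∧ (openGraph (labelledOpen ends z)).Reachable s y').card with hG1
  set F2 := (univ.filter fun z : α → Bool => (openGraph (labelledOpen ends z)).Reachable a c).card with hF2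
  set G2 := (univ.filter fun z : α → Bool => ¬ (openGraph (labelledOpen ends z)).Reachable a c ∧
      ∃ l, z l = false ∧ ∃ x y' : V, ends l = s(x, y') ∧
        (openGraph (labelledOpen ends z)).Reachable a x ∧ (openGraph (labelledOpen ends z)).Reachable c y').card with hG2
  set Q1 := (univ.filter fun z : α → Bool =>
        (openGraph (labelledOpen ends z)).Reachable a s ∧
        (¬ (openGraph (labelledOpen ends z)).Reachable a c ∧
          ∃ l, z l = false ∧ ∃ x y' : V, ends l = s(x, y') ∧
            (openGraph (labelledOpen ends z)).Reachable a x ∧ (openGraph (labelledOpen ends z)).Reachable c y')).card with hQ1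
  set Q2 := (univ.filter fun z : α → Bool =>
        (¬ (openGraph (labelledOpen ends z)).Reachable a s ∧
          ∃ l, z l = false ∧ ∃ x y' : V, ends l = s(x, y') ∧
            (openGraph (labelledOpen ends z)).Reachable a x ∧ (openGraph (labelledOpen ends z)).Reachable s y') ∧
        (openGraph (labelledOpen ends z)).Reachable a c).card with hQ2
  have hUpos : 0 < U := Finset.card_pos.mpr Finset.univ_nonempty
  have key : B * U * (B * U) ≤ Q1 * U * (Q2 * U) := by
    rw [hIbad, hIP1, hIP2]
    calc E1 * E2 * (E1 * E2) = (E1 * E1) * (E2 * E2) := by ring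
      _ ≤ (F1 * G1) * (G2 * F2) := Nat.mul_le_mul (Nat.mul_le_mul e1F e1G) (Nat.mul_le_mul e2G e2F)
      _ = F1 * G2 * (G1 * F2) := by ring
  have key' : B ^ 2 * (U * U) ≤ Q1 * Q2 * (U * U) := by
    calc B ^ 2 * (U * U) = B * U * (B * U) := by ring
      _ ≤ Q1 * U * (Q2 * U) := key
      _ = Q1 * Q2 * (U * U) := by ring
  exact Nat.le_of_mul_le_mul_right key' (Nat.mul_pos hUpos hUpos)

end CutVertexAdj

end Summit.CriticalPhenomena.PercolationContinuityZ3.Theorems.ProductFormFibre
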